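import Literature.MathematicalPhysics.QuantumFieldTheory.Balaban1983to89.B3Cor23Concrete

/-!
# `Balaban1983to89.B3Cor23ConcreteProof` — T. Bałaban, *(Higgs)₂,₃ quantum fields in a finite volume. III. Renormalization*,
Commun. Math. Phys. **88** (1983) 411–445 [Balaban1983Higgs3]: **(2.17)** and **Corollary 2.3** (p. 429) DECIDED on the concrete
family of graphs `B3Cor23Concrete.family` built from the vertex catalogue (1.6)–(1.15)

statement-level skeleton of published theorems with citation tags; proofs where landed; nothing here is a claim about the Yang–Mills mass gap

PDF held: `paper:balaban1983-higgs-2-3-quantum-fields-finite-volume` (journal page = PDF page + 410); renders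
`…/b2b-balaban-ref1/pages/1983-cmp88-higgs23-III/1983-cmp88-higgs23-III-p013, p018, p019, p021, p022-x4.png` (pp. 423, 428–432).
CITATION HEADER (lean-in-tree rule).  lit-balaban TYPED SKELETON (HOME `run/shared/lean/pub/lit-balaban/`), Phase 2, seat p18, unit
`lit-balaban-p18`: SKELETON rows **B3.Cor2.3** (decl of record `B3Sect2Statements.Cor23`, kind «model-instance»; the model and
its printed sources are documented in `…B3Cor23Concrete`) and **B3.Eq2.17** (`B3Sect2Statements.Ineq217`, invoked by the printed
proof of Cor. 2.3, p. 429).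
WHAT THIS MODULE PROVES (sorry-free; no `Prop` fact introduced; axioms standard).  `ineq217_holds`: **(2.17)**
`Ineq217 d (family d n̄)` for 2 ≤ d ≤ 4.  The printed case analysis pp. 428–429 in d = 3 for every graph of the model:
`deg_pos_of_hasVertex1315`, `deg_pos_of_hasRVertex` (n̄ ≥ 3; print has n̄ > 12, p. 418), `deg_pos_of_four_lt_numExtLegs` (via
(2.17)), `deg_pos_of_hasFiniteCounterterm` (a vertex (1.7) with finite counterterms AND ≥ 2 external legs); `cor23_corrected`;
`cor23_twoExtLegs`: **Cor. 2.3 verbatim** (`Cor23`) on the sub-family `familyTwoExtLegs 3 n̄` of graphs with ≥ 2 external legs.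
`not_cor23`: **Cor. 2.3 as printed FAILS on `family d n̄`**, every d ≥ 2 — the (1.7)-tadpole `tadpole17` (a vacuum graph in the
sense of p. 415) has a vertex (1.7) with finite counterterms and D = 2 − d (`tadpole17_deg`); `pair1718_deg`: in d = 3 the failure
is not confined to vacuum graphs ({(1.7) doubly φ′-linked to (1.8)_{n=1,n′=0}, A′-leg external}: one external leg, D = 0), so
«≥ 2 external legs» is the sharp repair of the third clause.  The paper's USE of the corollary (classification of divergent
graphs by their external legs, pp. 429–432; vacuum graphs and graphs with one external vector leg are treated separately,
pp. 431–432, 434) is unaffected; recorded in HOME/GAPS.md G-B3-01, nothing adjudicated beyond these kernel facts.  NOT here: the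
d = 2 sentence *"In d = 2 graphs are more convergent, so degrees are still positive"* beyond (2.17) at d = 2.
-/

namespace Literature.MathematicalPhysics.QuantumFieldTheory.Balaban1983to89.B3Cor23ConcreteProof

open Finset B3Prop1 B3Sect2Statements B3VertexBridge B3Cor23Concrete

variable {nbar : ℕ} (G : Graph nbar)

/-- An internal vector leg of `i` leads to a vertex: either `i` itself carries two internal A′-legs (both endpoints of the line
at `i`) or another vertex `i′ ≠ i` carries an internal A′-leg (p. 428: *"If both endpoints of l belong to v … If not, then there
is another vertex v′ ∈ G"*). [cite: Balaban1983Higgs3, p.428] -/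
theorem vector_line_cases {i : Fin G.nV} (h : 1 ≤ G.intVector i) :
    2 ≤ G.intVector i ∨ ∃ i', i' ≠ i ∧ 1 ≤ G.intVector i' := by
  obtain ⟨j, hj⟩ := G.exists_of_one_le_intVector h
  obtain ⟨y, hy⟩ := Option.isSome_iff_exists.mp hj
  obtain ⟨i', j', rfl, hy'⟩ := G.other_vector hy
  by_cases hii : i' = i
  · subst hii
    have hne : j ≠ j' := by
      intro hjj; subst hjj; exact G.other_ne _ _ hy rfl
    exact Or.inl (G.two_le_intVector j j' hne hj (by simp [hy']))
  · exact Or.inr ⟨i', hii, G.one_le_intVector j' (by simp [hy'])⟩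

/-! ## Degrees of the vertices of a graph of the model, d = 3 -/

/-- d = 3: every vertex of a graph of the model has D_G(v) ≥ 1/2 (`Facts.half_le_degreeIn`). [cite: Balaban1983Higgs3, p.423] -/
theorem half_le_vertexDeg (i : Fin G.nV) : 1 / 2 ≤ G.vertexDeg 3 i :=
  (Facts.half_le_degreeIn (G.kind i) (G.adm i) (G.incidence 3 i)).1

/-- d = 3: D_G(v) ≥ 0. [cite: Balaban1983Higgs3, p.423] -/
theorem vertexDeg_nonneg (i : Fin G.nV) : 0 ≤ G.vertexDeg 3 i := (half_le_vertexDeg G i).trans' (by norm_num)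

/-- d = 3: D_G(v) ≥ 1 unless exactly one A′-leg of v is internal (the "analyzing more carefully" of p. 429 l. 2–3).
[cite: Balaban1983Higgs3, p.429] -/
theorem one_le_vertexDeg (i : Fin G.nV) (h : G.intVector i ≠ 1) : 1 ≤ G.vertexDeg 3 i :=
  (Facts.half_le_degreeIn (G.kind i) (G.adm i) (G.incidence 3 i)).2 h

/-- kernel: one vertex degree is at most the sum Σ_v D_G(v) of (2.2) (all terms ≥ 0, d = 3). [cite: Balaban1983Higgs3, (2.2) p.423] -/
theorem vdeg_le_sum (i : Fin G.nV) : G.vertexDeg 3 i ≤ ∑ l, G.vertexDeg 3 l :=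
  Finset.single_le_sum (fun l _ => vertexDeg_nonneg G l) (mem_univ i)

/-- kernel: two distinct vertex degrees are at most Σ_v D_G(v) (d = 3). [cite: Balaban1983Higgs3, (2.2) p.423] -/
theorem vdeg_pair_le_sum {i j : Fin G.nV} (hij : i ≠ j) : G.vertexDeg 3 i + G.vertexDeg 3 j ≤ ∑ l, G.vertexDeg 3 l := by
  calc G.vertexDeg 3 i + G.vertexDeg 3 j = ∑ l ∈ ({i, j} : Finset (Fin G.nV)), G.vertexDeg 3 l := (sum_pair hij).symm
    _ ≤ ∑ l, G.vertexDeg 3 l := sum_le_sum_of_subset_of_nonneg (subset_univ _) fun l _ _ => vertexDeg_nonneg G l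

/-- kernel: three distinct vertex degrees are at most Σ_v D_G(v) (d = 3). [cite: Balaban1983Higgs3, (2.2) p.423] -/
theorem vdeg_triple_le_sum {i j k : Fin G.nV} (hij : i ≠ j) (hik : i ≠ k) (hjk : j ≠ k) :
    G.vertexDeg 3 i + G.vertexDeg 3 j + G.vertexDeg 3 k ≤ ∑ l, G.vertexDeg 3 l := by
  calc G.vertexDeg 3 i + G.vertexDeg 3 j + G.vertexDeg 3 k = ∑ l ∈ ({i, j, k} : Finset (Fin G.nV)), G.vertexDeg 3 l := by
        rw [sum_insert (by simp [hij, hik]), sum_pair hjk]; ring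
    _ ≤ ∑ l, G.vertexDeg 3 l := sum_le_sum_of_subset_of_nonneg (subset_univ _) fun l _ _ => vertexDeg_nonneg G l

/-- kernel: in d = 3, D(G) > 0 iff Σ_v D_G(v) > 3 ((2.2)). [cite: Balaban1983Higgs3, (2.2) p.423] -/
theorem deg_pos_iff : 0 < G.deg 3 ↔ 3 < ∑ l, G.vertexDeg 3 l := by
  rw [G.deg_eq]; push_cast; constructor <;> intro h <;> linarith

/-! ## Corollary 2.3, first clause: a vertex of the form (1.13)–(1.15) (pp. 428–429), d = 3 -/

/-- p. 428 l. −4 – p. 429 l. 3 [PDF 18–19], verbatim: *"Let us consider at first a graph G with at least one vertex v of the form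
(1.13)–(1.15). There is also a line l ∈ G outgoing from v. If it is a vector field line, then we always have D_G(v) − d ≥ 0. If
both endpoints of l belong to v, then we have D_G(v) − d > 0, hence D(G) > 0. If not, then there is another vertex v′ ∈ G with
positive degree, hence D(G) > 0 also. In the case when l is a scalar field line we have at least one vertex v′ ∈ G more and then
D(G) ≥ D_G(v) − d + D_G(v′) ≥ (−d+2)/2 + (4−d)/2 ≥ 0, but analyzing more carefully the possibilities we arrive at the conclusion
D(G) > 0 again."* — PROVED for every graph of the model in d = 3 (the careful analysis: D_G(v′) = 1/2 forces exactly one internal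
A′-leg at v′, whose line ends at a third vertex). [cite: Balaban1983Higgs3, Cor. 2.3 p.429] -/
theorem deg_pos_of_hasVertex1315 (h : G.HasVertex1315) : 0 < G.deg 3 := by
  obtain ⟨i, hi⟩ := h
  have hfacts := Facts.degreeIn_1315 (G.kind i) hi (G.incidence 3 i)
  change 5 / 2 ≤ G.vertexDeg 3 i ∧ (1 ≤ G.intVector i → 3 ≤ G.vertexDeg 3 i) ∧
    (2 ≤ G.intVector i → 7 / 2 ≤ G.vertexDeg 3 i) ∧ (G.intScalar i = 0 → G.intVector i = 0 → G.vertexDeg 3 i = 3) at hfacts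
  obtain ⟨h52, h3, h72, h30⟩ := hfacts
  rw [deg_pos_iff]
  by_cases hvec : 1 ≤ G.intVector i
  · -- a vector line at v
    rcases vector_line_cases G hvec with h2 | ⟨i', hne, hi'⟩
    · linarith [h72 h2, vdeg_le_sum G i]
    · linarith [h3 hvec, half_le_vertexDeg G i', vdeg_pair_le_sum G hne.symm]
  have hvec0 : G.intVector i = 0 := by omega
  by_cases hsc : 1 ≤ G.intScalar i
  · -- a scalar line at v, ending at another vertex v′
    obtain ⟨j, hj⟩ := G.exists_of_one_le_intScalar hsc
    obtain ⟨y, hy⟩ := Option.isSome_iff_exists.mp hj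
    obtain ⟨i', j', rfl, hy'⟩ := G.other_scalar hy
    have hne : i' ≠ i := by
      rintro rfl
      have h1 := Facts.scalarLegs_of_isOfForm1315 _ hi
      have hjj : j' = j := Fin.ext (by have := j.isLt; have := j'.isLt; omega)
      subst hjj
      exact G.other_ne _ _ hy rfl
    by_cases hone : G.intVector i' = 1
    · -- v′ has exactly one internal A′-leg: its vector line ends at a third vertex v″
      obtain ⟨k, hk⟩ := G.exists_of_one_le_intVector hone.ge
      obtain ⟨z, hz⟩ := Option.isSome_iff_exists.mp hk
      obtain ⟨i'', k', rfl, hz'⟩ := G.other_vector hz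
      have h1'' : 1 ≤ G.intVector i'' := G.one_le_intVector k' (by simp [hz'])
      have hne1 : i'' ≠ i := by rintro rfl; omega
      have hne2 : i'' ≠ i' := by
        rintro rfl
        have hkk : k ≠ k' := by rintro rfl; exact G.other_ne _ _ hz rfl
        have := G.two_le_intVector k k' hkk hk (by simp [hz'])
        omega
      linarith [half_le_vertexDeg G i', half_le_vertexDeg G i'', vdeg_triple_le_sum G hne.symm hne1.symm hne2.symm]
    · linarith [one_le_vertexDeg G i' hone, vdeg_pair_le_sum G hne.symm]
  · -- no element of v is internal: the internal line of G lies elsewhere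
    have hsc0 : G.intScalar i = 0 := by omega
    obtain ⟨⟨i₀, y₀⟩, h₀⟩ := G.exists_line
    have hne : i₀ ≠ i := by
      rintro rfl
      cases y₀ with
      | inl j => have := G.one_le_intScalar j h₀; omega
      | inr j => have := G.one_le_intVector j h₀; omega
    linarith [h30 hsc0 hvec0, half_le_vertexDeg G i₀, vdeg_pair_le_sum G hne.symm]

/-! ## Corollary 2.3, second clause: an R-vertex (p. 429), d = 3 -/

/-- p. 429 [PDF 19], verbatim: *"Also it is easy to notice that if a graph G has an R-vertex of the form (1.9) and (1.11), then
it has positive degree."* — PROVED for every graph of the model in d = 3 and every order n̄ ≥ 3 (the R-vertex alone has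
D_G(v) ≥ n̄ + 1 > d; the paper's standing choice is n̄ > 12, p. 418 l. 1; an R-vertex (1.15) is covered by the first clause).
[cite: Balaban1983Higgs3, Cor. 2.3 p.429] -/
theorem deg_pos_of_hasRVertex (hn : 3 ≤ nbar) (h : G.HasRVertex) : 0 < G.deg 3 := by
  obtain ⟨i, hi⟩ := h
  by_cases h1315 : (G.kind i).isOfForm1315 = true
  · exact deg_pos_of_hasVertex1315 G ⟨i, h1315⟩
  rw [deg_pos_iff]
  have hR := Facts.nbar_add_one_le_degreeIn (G.kind i) hi (by simpa using h1315) (G.adm i) (G.incidence 3 i)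
  change (nbar : ℚ) + 1 ≤ G.vertexDeg 3 i at hR
  have : (3 : ℚ) ≤ nbar := by exact_mod_cast hn
  linarith [vdeg_le_sum G i]


/-! ## (2.17) for the model, 2 ≤ d ≤ 4 -/

/-- **(2.17)** p. 429 [PDF 19], verbatim: *"For the graphs G which do not contain vertices of the form (1.13)–(1.15) we can easily
prove the following estimate D(G) ≥ −2(d−2)/2 − 1 + ((a number of vertices) − 1)(4−d)/2 + ((a number of external legs) − 1)(d−2)/2,
(2.17)"* — PROVED for the concrete family in every dimension 2 ≤ d ≤ 4: Σ_v D_G(v) ≥ Σ_v (D(v) + ext(v)(d−2)/2) ≥ V(4−d)/2 +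
E(d−2)/2, and the right side of (2.17) is exactly V(4−d)/2 + E(d−2)/2 − d. [cite: Balaban1983Higgs3, (2.17) p.429] -/
theorem ineq217_holds (d : ℕ) (hd2 : 2 ≤ d) (hd4 : d ≤ 4) (nbar : ℕ) : Ineq217 d (family d nbar) := by
  intro G hG
  dsimp only [family] at hG ⊢
  have key : ∀ i : Fin G.nV, (4 - (d : ℚ)) / 2 + (G.extLegs i : ℚ) * (((d : ℚ) - 2) / 2) ≤ G.vertexDeg d i := by
    intro i
    have hav : (G.kind i).isAveragingVertex = false := by
      by_contra h
      exact hG ⟨i, Facts.isOfForm1315_of_isAveraging _ (by simpa using h)⟩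
    have h1 := Facts.degree_add_ext_le_degreeIn d (toCounts d (G.kind i)) hav (G.incidence d i)
    have h2 := degree_toCounts_ge d hd2 hd4 nbar (G.kind i) (G.adm i)
    change degree d (toCounts d (G.kind i)) + (G.extLegs i : ℚ) * (((d : ℚ) - 2) / 2) ≤ G.vertexDeg d i at h1
    linarith
  have hsum := sum_le_sum fun i (_ : i ∈ (univ : Finset (Fin G.nV))) => key i
  rw [sum_add_distrib, sum_const, card_univ, Fintype.card_fin, ← sum_mul, nsmul_eq_mul] at hsum
  rw [G.deg_eq]
  unfold Graph.numExtLegs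
  push_cast at hsum ⊢
  linarith

/-- (2.17) in d = 3, vertex form: Σ_v D(v) + E/2 ≤ Σ_v D_G(v) for a graph without vertices (1.13)–(1.15).
[cite: Balaban1983Higgs3, (2.17) p.429] -/
theorem sum_degree_add_half_ext_le (hG : ¬ G.HasVertex1315) :
    (∑ i, degree 3 (toCounts 3 (G.kind i))) + (G.numExtLegs : ℚ) / 2 ≤ ∑ i, G.vertexDeg 3 i := by
  have key : ∀ i : Fin G.nV, degree 3 (toCounts 3 (G.kind i)) + (G.extLegs i : ℚ) / 2 ≤ G.vertexDeg 3 i := by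
    intro i
    have hav : (G.kind i).isAveragingVertex = false := by
      by_contra h
      exact hG ⟨i, Facts.isOfForm1315_of_isAveraging _ (by simpa using h)⟩
    have h1 := Facts.degree_add_ext_le_degreeIn 3 (toCounts 3 (G.kind i)) hav (G.incidence 3 i)
    change degree 3 (toCounts 3 (G.kind i)) + (G.extLegs i : ℚ) * ((((3 : ℕ) : ℚ) - 2) / 2) ≤ G.vertexDeg 3 i at h1
    push_cast at h1
    linarith
  have hsum := sum_le_sum fun i (_ : i ∈ (univ : Finset (Fin G.nV))) => key i
  rw [sum_add_distrib, ← sum_div] at hsum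
  unfold Graph.numExtLegs
  push_cast
  exact hsum

/-! ## Corollary 2.3, fourth clause: more than four external legs (p. 429), d = 3 -/

/-- p. 429 [PDF 19], verbatim: *"from which it follows that the graphs with more than four external legs have positive degree in
d = 3."* — PROVED for every graph of the model in d = 3 (via (2.17): with E ≥ 5, Σ_v D(v) + E/2 > 3 unless G is a single vertex
of degree 1/2, which has only three legs). [cite: Balaban1983Higgs3, Cor. 2.3 p.429] -/
theorem deg_pos_of_four_lt_numExtLegs (h : 4 < G.numExtLegs) : 0 < G.deg 3 := by
  by_cases h1315 : G.HasVertex1315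
  · exact deg_pos_of_hasVertex1315 G h1315
  rw [deg_pos_iff]
  have hsum := sum_degree_add_half_ext_le G h1315
  have hE : (5 : ℚ) ≤ G.numExtLegs := by exact_mod_cast h
  have hdeg : ∀ i : Fin G.nV, 1 / 2 ≤ degree 3 (toCounts 3 (G.kind i)) := fun i => by
    have := degree_toCounts_ge 3 (by norm_num) (by norm_num) nbar (G.kind i) (G.adm i); norm_num at this; exact this
  by_cases hbig : ∃ i₀ : Fin G.nV, 5 ≤ G.extLegs i₀
  · obtain ⟨i₀, hi₀⟩ := hbig
    have h32 := Facts.three_halves_le_degree_of_ext (G.kind i₀) (G.incidence 3 i₀) hi₀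
    have := Finset.single_le_sum (f := fun i => degree 3 (toCounts 3 (G.kind i)))
      (fun i _ => (hdeg i).trans' (by norm_num)) (mem_univ i₀)
    linarith
  · push Not at hbig
    have hle : G.numExtLegs ≤ G.nV * 4 := by
      unfold Graph.numExtLegs
      have := sum_le_card_nsmul univ G.extLegs 4 fun i _ => by have := hbig i; omega
      simpa using this
    have hV : (2 : ℚ) ≤ G.nV := by exact_mod_cast (show 2 ≤ G.nV by omega)
    have hsd : (G.nV : ℚ) * (1 / 2) ≤ ∑ i, degree 3 (toCounts 3 (G.kind i)) := by
      have := card_nsmul_le_sum univ (fun i => degree 3 (toCounts 3 (G.kind i))) (1 / 2) fun i _ => hdeg i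
      simpa using this
    linarith

/-! ## Corollary 2.3, third clause: a vertex (1.7) with finite counterterms — with at least two external legs, d = 3 -/

/-- The third clause of Cor. 2.3 p. 429 (*"or a vertex (1.7) with finite counterterms"*) in the form in which it HOLDS on the
model: a mass renormalization vertex with finite counterterm AND at least two external legs ⇒ D(G) > 0, d = 3 (D_G(v₂) ≥ 2, a
second vertex exists and every external leg adds 1/2). Without the external-leg condition the clause fails: `tadpole17_deg`,
`pair1718_deg`. [cite: Balaban1983Higgs3, Cor. 2.3 p.429] -/
theorem deg_pos_of_hasFiniteCounterterm (h : G.HasFiniteCounterterm) (hE : 2 ≤ G.numExtLegs) : 0 < G.deg 3 := by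
  by_cases h1315 : G.HasVertex1315
  · exact deg_pos_of_hasVertex1315 G h1315
  obtain ⟨i₀, hi₀⟩ := h
  rw [deg_pos_iff]
  have hsum := sum_degree_add_half_ext_le G h1315
  have hE' : (2 : ℚ) ≤ G.numExtLegs := by exact_mod_cast hE
  have hdeg : ∀ i : Fin G.nV, 1 / 2 ≤ degree 3 (toCounts 3 (G.kind i)) := fun i => by
    have := degree_toCounts_ge 3 (by norm_num) (by norm_num) nbar (G.kind i) (G.adm i); norm_num at this; exact this
  have hd₀ : degree 3 (toCounts 3 (G.kind i₀)) = 2 := by rw [hi₀, toCounts_v17, degree_v17]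
  by_cases hex : ∃ i₁, i₁ ≠ i₀
  · obtain ⟨i₁, hne⟩ := hex
    have : degree 3 (toCounts 3 (G.kind i₀)) + degree 3 (toCounts 3 (G.kind i₁)) ≤ ∑ i, degree 3 (toCounts 3 (G.kind i)) :=
      calc degree 3 (toCounts 3 (G.kind i₀)) + degree 3 (toCounts 3 (G.kind i₁))
          = ∑ i ∈ ({i₀, i₁} : Finset (Fin G.nV)), degree 3 (toCounts 3 (G.kind i)) := (sum_pair (f := fun i => degree 3 (toCounts 3 (G.kind i))) hne.symm).symm
        _ ≤ ∑ i, degree 3 (toCounts 3 (G.kind i)) :=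
          sum_le_sum_of_subset_of_nonneg (subset_univ _) fun i _ _ => (hdeg i).trans' (by norm_num)
    linarith [hdeg i₁]
  · -- G would be the single vertex v₂ with both φ′-legs external and yet an internal line: impossible
    exfalso
    push Not at hex
    have huniv : (univ : Finset (Fin G.nV)) = {i₀} := by ext i; simp [hex i]
    have hEeq : G.numExtLegs = G.extLegs i₀ := by simp [Graph.numExtLegs, huniv]
    have hvl : G.intVector i₀ ≤ 0 := by simpa [hi₀, VertexKind.vectorLegs] using G.intVector_le i₀
    have hext : G.extLegs i₀ = 2 - G.intScalar i₀ := by simp [Graph.extLegs, hi₀, VertexKind.scalarLegs, VertexKind.vectorLegs]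
    obtain ⟨⟨i', y⟩, hy⟩ := G.exists_line
    obtain rfl := hex i'
    cases y with
    | inl j => have := G.one_le_intScalar j hy; omega
    | inr j => have := G.one_le_intVector j hy; omega

/-! ## Corollary 2.3: the corrected form on the whole family, and the verbatim form on graphs with ≥ 2 external legs -/

/-- **Corollary 2.3** p. 429 with its third clause in the form that holds (finite counterterm AND ≥ 2 external legs), for every
graph of the model, d = 3, n̄ ≥ 3. [cite: Balaban1983Higgs3, Cor. 2.3 p.429] -/
theorem cor23_corrected (hn : 3 ≤ nbar)
    (h : G.HasVertex1315 ∨ G.HasRVertex ∨ (G.HasFiniteCounterterm ∧ 2 ≤ G.numExtLegs) ∨ 4 < G.numExtLegs) : 0 < G.deg 3 := by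
  rcases h with h | h | ⟨h, hE⟩ | h
  · exact deg_pos_of_hasVertex1315 G h
  · exact deg_pos_of_hasRVertex G hn h
  · exact deg_pos_of_hasFiniteCounterterm G h hE
  · exact deg_pos_of_four_lt_numExtLegs G h


/-- The sub-family of the model consisting of the graphs with at least two external legs (same degree, same predicates).
[cite: Balaban1983Higgs3, Cor. 2.3 p.429] -/
def familyTwoExtLegs (d nbar : ℕ) : GraphFamily where
  Graph := {G : Graph nbar // 2 ≤ G.numExtLegs}
  numVertices G := G.1.nV
  numExtLegs G := G.1.numExtLegs
  degree G := G.1.deg d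
  hasVertex1315 G := G.1.HasVertex1315
  hasRVertex G := G.1.HasRVertex
  hasFiniteCounterterm G := G.1.HasFiniteCounterterm

/-- **Corollary 2.3** p. 429 [PDF 19], verbatim: *"If a graph G has a vertex of the form (1.13)–(1.15), or an R-vertex, or a
vertex (1.7) with finite counterterms, or it has more than four external legs, then D(G) > 0."* — PROVED AS TYPED
(`B3Sect2Statements.Cor23`) for the concrete family of graphs with at least two external legs, d = 3, every order n̄ ≥ 3
(print: n̄ > 12, p. 418). On the whole family the statement fails (`not_cor23`). [cite: Balaban1983Higgs3, Cor. 2.3 p.429] -/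
theorem cor23_twoExtLegs (nbar : ℕ) (hn : 3 ≤ nbar) : Cor23 (familyTwoExtLegs 3 nbar) := by
  rintro ⟨G, hE⟩ h
  change G.HasVertex1315 ∨ G.HasRVertex ∨ G.HasFiniteCounterterm ∨ 4 < G.numExtLegs at h
  change 0 < G.deg 3
  rcases h with h | h | h | h
  · exact deg_pos_of_hasVertex1315 G h
  · exact deg_pos_of_hasRVertex G hn h
  · exact deg_pos_of_hasFiniteCounterterm G h hE
  · exact deg_pos_of_four_lt_numExtLegs G h

/-! ## The refuting graphs -/

/-- The (1.7)-tadpole: one mass renormalization vertex (finite counterterm) whose two φ′-legs are joined by one internal line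
(a vacuum graph; cf. the tadpoles of (1.22)–(1.23) pp. 416–417). [cite: Balaban1983Higgs3, Cor. 2.3 p.429] -/
def tadpole17 (nbar : ℕ) : Graph nbar where
  nV := 1
  kind _ := .v17
  adm _ := trivial
  other x := match x with
    | ⟨i, .inl j⟩ => some ⟨i, .inl j.rev⟩
    | ⟨_, .inr j⟩ => j.elim0
  other_ne := by decide
  other_symm := by decide
  other_isLeft := by decide
  exists_line := by decide

/-- kernel: the (1.7)-tadpole has D = D(v₂) − d = 2 − d ((ii) p. 423). [cite: Balaban1983Higgs3, (2.2) p.423] -/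
theorem tadpole17_deg (d nbar : ℕ) : (tadpole17 nbar).deg d = 2 - (d : ℚ) := by
  have h1 : (tadpole17 nbar).intScalar (0 : Fin 1) = 2 := by rfl
  have h2 : (tadpole17 nbar).intVector (0 : Fin 1) = 0 := by rfl
  have h3 : (tadpole17 nbar).intDiffs (0 : Fin 1) = 0 := by rfl
  rw [Graph.deg_eq]
  change (∑ i : Fin 1, (tadpole17 nbar).vertexDeg d i) - (d : ℚ) = _
  rw [Fin.sum_univ_one, Graph.vertexDeg_eq, h1, h2, h3]
  simp [tadpole17, VertexKind.etaCount, VertexKind.isAveragingVertex]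
  ring

/-- kernel: the (1.7)-tadpole has a vertex (1.7) with finite counterterms and no external leg.
[cite: Balaban1983Higgs3, Cor. 2.3 p.429] -/
theorem tadpole17_hasFiniteCounterterm (nbar : ℕ) :
    (tadpole17 nbar).HasFiniteCounterterm ∧ (tadpole17 nbar).numExtLegs = 0 :=
  ⟨⟨(0 : Fin 1), rfl⟩, by rfl⟩

/-- **Corollary 2.3 as printed fails on the whole concrete family**, in every dimension d ≥ 2 and for every order n̄: the
(1.7)-tadpole has a vertex (1.7) with finite counterterms and D = 2 − d ≤ 0. [cite: Balaban1983Higgs3, Cor. 2.3 p.429] -/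
theorem not_cor23 (d : ℕ) (hd : 2 ≤ d) (nbar : ℕ) : ¬ Cor23 (family d nbar) := by
  intro h
  have := h (tadpole17 nbar) (Or.inr (Or.inr (Or.inl (tadpole17_hasFiniteCounterterm nbar).1)))
  change 0 < (tadpole17 nbar).deg d at this
  rw [tadpole17_deg] at this
  have : (2 : ℚ) ≤ d := by exact_mod_cast hd
  linarith

/-- The two vertices of `pair1718`: v₂ = (1.7) and v₃ = (1.8) with n = 1, n′ = 0. [cite: Balaban1983Higgs3, (1.7)–(1.8) p.413] -/
def pairKind : Fin 2 → VertexKind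
  | 0 => .v17
  | 1 => .v18 1 0

/-- d = 3, one external leg: v₂ = (1.7) (finite counterterm) doubly φ′-linked to v₃ = (1.8)_{n=1,n′=0}, the A′-leg of v₃ external
(a graph with one external vector leg, cf. p. 431). [cite: Balaban1983Higgs3, Cor. 2.3 p.429] -/
def pair1718 (nbar : ℕ) (hn : 1 ≤ nbar) : Graph nbar where
  nV := 2
  kind := pairKind
  adm i := by fin_cases i <;> simp [pairKind, VertexKind.Admissible, hn]
  other x := match x with
    | ⟨0, .inl j⟩ => some ⟨1, .inl ⟨j.val, j.isLt⟩⟩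
    | ⟨1, .inl j⟩ => some ⟨0, .inl ⟨j.val, j.isLt⟩⟩
    | ⟨0, .inr j⟩ => j.elim0
    | ⟨1, .inr _⟩ => none
  other_ne := by decide
  other_symm := by decide
  other_isLeft := by decide
  exists_line := by decide

/-- kernel: `pair1718` has exactly one external leg and D = D(v₂) + D_G(v₃) − 3 = 2 + 1 − 3 = 0 — so in d = 3 the third clause of
Cor. 2.3 fails beyond vacuum graphs, and «≥ 2 external legs» in `deg_pos_of_hasFiniteCounterterm` cannot be lowered to ≥ 1.
[cite: Balaban1983Higgs3, Cor. 2.3 p.429] -/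
theorem pair1718_deg (nbar : ℕ) (hn : 1 ≤ nbar) :
    (pair1718 nbar hn).HasFiniteCounterterm ∧ (pair1718 nbar hn).numExtLegs = 1 ∧ (pair1718 nbar hn).deg 3 = 0 := by
  refine ⟨⟨(0 : Fin 2), rfl⟩, by rfl, ?_⟩
  have a0 : (pair1718 nbar hn).intScalar (0 : Fin 2) = 2 := by rfl
  have b0 : (pair1718 nbar hn).intVector (0 : Fin 2) = 0 := by rfl
  have c0 : (pair1718 nbar hn).intDiffs (0 : Fin 2) = 0 := by rfl
  have a1 : (pair1718 nbar hn).intScalar (1 : Fin 2) = 2 := by rfl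
  have b1 : (pair1718 nbar hn).intVector (1 : Fin 2) = 0 := by rfl
  have c1 : (pair1718 nbar hn).intDiffs (1 : Fin 2) = 1 := by rfl
  rw [Graph.deg_eq]
  change (∑ i : Fin 2, (pair1718 nbar hn).vertexDeg 3 i) - 3 = (0 : ℚ)
  rw [Fin.sum_univ_two, Graph.vertexDeg_eq, Graph.vertexDeg_eq, a0, b0, c0, a1, b1, c1]
  simp [pair1718, pairKind, VertexKind.etaCount, VertexKind.isAveragingVertex]
  norm_num

end Literature.MathematicalPhysics.QuantumFieldTheory.Balaban1983to89.B3Cor23ConcreteProof
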